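import Mathlib
import HarnessLib
import Summits.Ventures.LatticeQCDFlow.Exactness.InvariantComposition
import Summits.Ventures.LatticeQCDFlow.Exactness.CabibboMarinariSweep

/-!
# Adjoint pairs of Markov kernels on a general state space: the reversed cycle is the adjoint of the cycle

HONEST FRAMING: exact (Metropolis-corrected) sampling algorithms for lattice gauge theory;
figures of merit are autocorrelation/cost numbers at stated couplings and volumes; no
continuum-physics claim.

Venture `LatticeQCDFlow` (cell pub-lqcd), topic `Exactness`, FANOUT row 9 (eng-latcore; the
engine's `reverse=True` scans — sites, directions and SU(2) subgroups in the opposite order — which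
the non-equilibrium / tempering clients (`latflow.snf`, `fthmc`) consume as the ADJOINT of the forward
sweep).  NEW WORK of the cell over Mathlib's kernel library (`Measure.compProd`,
`Measure.lintegral_compProd`, `Kernel.comp`); nothing is cited as a fact.  Printed counterpart, named
only: Neal 1996 ("mutually reversible" kernels).

`SequentialScanAdjoint.lean` proves "the reverse-order scan is the π-adjoint of the forward scan"
for FINITE state spaces (matrices); `CrooksReversal.lean` / `TemperedTransitions.lean` take such
adjoint pairs (`MutuallyReversible`) as hypotheses, again finite.  This file is the general-state
counterpart for Mathlib `Kernel`s, phrased through the composition-product measure: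

## Content (`π` a finite measure on `α`, kernels Markov)

* `IsAdjointPair κ κ' π` — `∫_A κ(x, B) dπ = ∫_B κ'(x, A) dπ` for all measurable `A, B`
  (`Kernel.IsReversible κ π` is `IsAdjointPair κ κ π`: `isAdjointPair_self_iff`); `IsAdjointPair.symm`,
  `isAdjointPair_id`.
* `IsAdjointPair.compProd_swap` — equivalently `(π ⊗ₘ κ').map swap = π ⊗ₘ κ` (π-system argument on
  rectangles), hence the FUNCTIONAL form `IsAdjointPair.lintegral_swap`:
  `∫∫ F x y κ(x,dy) π(dx) = ∫∫ F x y κ'(y,dx) π(dy)` for every measurable `F ≥ 0`.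
* **`IsAdjointPair.comp`** — adjoints compose in the opposite order:
  `(κ, κ')`, `(η, η')` adjoint ⇒ `(η ∘ₖ κ, κ' ∘ₖ η')` adjoint.
* `IsAdjointPair.invariant` — a kernel with a Markov adjoint leaves `π` invariant;
  **`isAdjointPair_cycle_reverse`** — for a list of `π`-reversible Markov kernels,
  `(cycle Ks, cycle Ks.reverse)` is an adjoint pair (`cycle` of `InvariantComposition.lean`): the
  reversed sweep is the `π`-adjoint of the forward sweep, on ANY measurable state space.
* Engine instance: **`cmLinkUpdate_reverse_isAdjointPair`** — the SU(N) link update with the subgroup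
  frames in reversed order is the adjoint of the forward one for the one-link Wilson law
  (`CabibboMarinariSweep.lean`, `cmHit_isReversible`).

Not here: σ-finite `π` (finite is what the Gibbs measures of the cell are), spectral statements.
-/

namespace Summit.Ventures.LatticeQCDFlow.Exactness

open MeasureTheory ProbabilityTheory
open scoped ENNReal

variable {α : Type*} [MeasurableSpace α] {π : Measure α}

/-! ## §1 Adjoint pairs -/

/-- `κ'` is a `π`-ADJOINT of `κ`: the flow `A → B` under `κ` equals the flow `B → A` under `κ'`. -/
def IsAdjointPair (κ κ' : Kernel α α) (π : Measure α) : Prop :=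
  ∀ ⦃A B⦄, MeasurableSet A → MeasurableSet B →
    ∫⁻ x in A, κ x B ∂π = ∫⁻ x in B, κ' x A ∂π

/-- Reversibility is self-adjointness. -/
theorem isAdjointPair_self_iff {κ : Kernel α α} : IsAdjointPair κ κ π ↔ Kernel.IsReversible κ π :=
  Iff.rfl

/-- A reversible kernel is its own adjoint. -/
theorem _root_.ProbabilityTheory.Kernel.IsReversible.isAdjointPair {κ : Kernel α α}
    (h : Kernel.IsReversible κ π) : IsAdjointPair κ κ π := h

/-- Adjointness is symmetric. -/
theorem IsAdjointPair.symm {κ κ' : Kernel α α} (h : IsAdjointPair κ κ' π) : IsAdjointPair κ' κ π :=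
  fun _ _ hA hB => (h hB hA).symm

/-- The identity kernel is self-adjoint: both flows are `π (A ∩ B)`. -/
theorem isAdjointPair_id : IsAdjointPair (Kernel.id : Kernel α α) Kernel.id π := by
  have h : ∀ (S T : Set α), MeasurableSet T →
      ∫⁻ x in S, (Kernel.id : Kernel α α) x T ∂π = π (T ∩ S) := by
    intro S T hT
    have h1 : ∀ x, (Kernel.id : Kernel α α) x T = T.indicator 1 x := fun x => by
      rw [Kernel.id_apply, Measure.dirac_apply' _ hT]
    simp_rw [h1]
    rw [lintegral_indicator_one hT, Measure.restrict_apply hT]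
  intro A B hA hB
  rw [h A B hB, h B A hA, Set.inter_comm]

/-- **A kernel with a Markov `π`-adjoint leaves `π` invariant.** -/
theorem IsAdjointPair.invariant {κ κ' : Kernel α α} [IsMarkovKernel κ'] (h : IsAdjointPair κ κ' π) :
    Kernel.Invariant κ π := by
  ext s hs
  calc (κ ∘ₘ π) s = ∫⁻ x, κ x s ∂π := by rw [Measure.bind_apply hs (Kernel.aemeasurable _)]
    _ = ∫⁻ x in Set.univ, κ x s ∂π := by rw [Measure.restrict_univ]
    _ = ∫⁻ x in s, κ' x Set.univ ∂π := h MeasurableSet.univ hs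
    _ = π s := by simp

/-! ## §2 The composition-product form and the functional form -/

/-- **Adjointness as an identity of measures on `α × α`**: `(π ⊗ₘ κ').map swap = π ⊗ₘ κ`. -/
theorem IsAdjointPair.compProd_swap [IsFiniteMeasure π] {κ κ' : Kernel α α} [IsMarkovKernel κ]
    [IsMarkovKernel κ'] (h : IsAdjointPair κ κ' π) :
    (π ⊗ₘ κ').map Prod.swap = π ⊗ₘ κ := by
  refine ext_of_generate_finite _ generateFrom_prod.symm isPiSystem_prod ?_ ?_
  · rintro _ ⟨A, hA, B, hB, rfl⟩
    rw [Measure.map_apply measurable_swap (hA.prod hB), Set.preimage_swap_prod,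
      Measure.compProd_apply_prod hB hA, Measure.compProd_apply_prod hA hB]
    exact (h hA hB).symm
  · rw [Measure.map_apply measurable_swap MeasurableSet.univ, Set.preimage_univ,
      Measure.compProd_apply_univ, Measure.compProd_apply_univ]

/-- **Functional form of adjointness**: for every measurable `F ≥ 0`,
`∫∫ F x y κ(x, dy) π(dx) = ∫∫ F x y κ'(y, dx) π(dy)`. -/
theorem IsAdjointPair.lintegral_swap [IsFiniteMeasure π] {κ κ' : Kernel α α} [IsMarkovKernel κ]
    [IsMarkovKernel κ'] (h : IsAdjointPair κ κ' π) {F : α → α → ℝ≥0∞}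
    (hF : Measurable (Function.uncurry F)) :
    ∫⁻ x, ∫⁻ y, F x y ∂κ x ∂π = ∫⁻ y, ∫⁻ x, F x y ∂κ' y ∂π := by
  have h1 : ∫⁻ x, ∫⁻ y, F x y ∂κ x ∂π = ∫⁻ p, Function.uncurry F p ∂(π ⊗ₘ κ) :=
    (Measure.lintegral_compProd hF).symm
  have h2 : ∫⁻ y, ∫⁻ x, F x y ∂κ' y ∂π
      = ∫⁻ p, Function.uncurry F (Prod.swap p) ∂(π ⊗ₘ κ') :=
    (Measure.lintegral_compProd (μ := π) (κ := κ')
      (f := fun p : α × α => Function.uncurry F p.swap) (hF.comp measurable_swap)).symm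
  rw [h1, h2, ← h.compProd_swap, lintegral_map hF measurable_swap]

/-- Set-integral of a composite kernel as a double integral with an indicator. -/
theorem setLIntegral_comp_eq (κ η : Kernel α α) {A B : Set α} (hA : MeasurableSet A)
    (hB : MeasurableSet B) :
    ∫⁻ x in A, (η ∘ₖ κ) x B ∂π = ∫⁻ x, ∫⁻ y, A.indicator 1 x * η y B ∂κ x ∂π := by
  rw [← lintegral_indicator hA]
  refine lintegral_congr fun x => ?_
  by_cases hx : x ∈ A
  · rw [Set.indicator_of_mem hx, Kernel.comp_apply' _ _ _ hB]
    simp only [Set.indicator_of_mem hx, Pi.one_apply, one_mul]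
  · simp only [Set.indicator_of_notMem hx, zero_mul, lintegral_const, zero_mul]

/-- **Adjoints compose in the opposite order**: `(κ, κ')` and `(η, η')` adjoint pairs ⇒
`(η ∘ₖ κ, κ' ∘ₖ η')` is an adjoint pair (first `κ` then `η`; adjoint: first `η'` then `κ'`). -/
theorem IsAdjointPair.comp [IsFiniteMeasure π] {κ κ' η η' : Kernel α α} [IsMarkovKernel κ]
    [IsMarkovKernel κ'] [IsMarkovKernel η] [IsMarkovKernel η'] (hκ : IsAdjointPair κ κ' π)
    (hη : IsAdjointPair η η' π) : IsAdjointPair (η ∘ₖ κ) (κ' ∘ₖ η') π := by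
  intro A B hA hB
  have mL : Measurable (Function.uncurry fun (x y : α) => A.indicator 1 x * η y B) :=
    ((measurable_one.indicator hA).comp measurable_fst).mul ((Kernel.measurable_coe η hB).comp
      measurable_snd)
  have mR : Measurable (Function.uncurry fun (x z : α) => B.indicator 1 x * κ' z A) :=
    ((measurable_one.indicator hB).comp measurable_fst).mul ((Kernel.measurable_coe κ' hA).comp
      measurable_snd)
  have eL : ∫⁻ x in A, (η ∘ₖ κ) x B ∂π = ∫⁻ y, κ' y A * η y B ∂π := by
    rw [setLIntegral_comp_eq κ η hA hB, hκ.lintegral_swap mL]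
    refine lintegral_congr fun y => ?_
    rw [lintegral_mul_const _ (measurable_one.indicator hA), lintegral_indicator_one hA]
  have eR : ∫⁻ x in B, (κ' ∘ₖ η') x A ∂π = ∫⁻ z, κ' z A * η z B ∂π := by
    rw [setLIntegral_comp_eq η' κ' hB hA, hη.symm.lintegral_swap mR]
    refine lintegral_congr fun z => ?_
    rw [lintegral_mul_const _ (measurable_one.indicator hB), lintegral_indicator_one hB, mul_comm]
  rw [eL, eR]

/-! ## §3 Cycles: the reversed sweep is the adjoint of the forward sweep -/

/-- A cycle of Markov kernels is Markov. -/
theorem isMarkovKernel_cycle {Ks : List (Kernel α α)} (h : ∀ κ ∈ Ks, IsMarkovKernel κ) :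
    IsMarkovKernel (cycle Ks) := by
  induction Ks with
  | nil => rw [cycle_nil]; infer_instance
  | cons κ ks ih =>
      rw [cycle_cons]
      haveI := h κ (by simp)
      haveI := ih fun η hη => h η (by simp [hη])
      infer_instance

/-- **The reversed cycle is the `π`-adjoint of the cycle**: for every list of `π`-reversible Markov
kernels, `(cycle Ks, cycle Ks.reverse)` is an adjoint pair — on any measurable state space. -/
theorem isAdjointPair_cycle_reverse [IsFiniteMeasure π] {Ks : List (Kernel α α)}
    (hM : ∀ κ ∈ Ks, IsMarkovKernel κ) (h : ∀ κ ∈ Ks, Kernel.IsReversible κ π) :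
    IsAdjointPair (cycle Ks) (cycle Ks.reverse) π := by
  induction Ks with
  | nil => simpa using (isAdjointPair_id (π := π))
  | cons κ ks ih =>
      have hMks : ∀ η ∈ ks, IsMarkovKernel η := fun η hη => hM η (by simp [hη])
      haveI := hM κ (by simp)
      haveI := isMarkovKernel_cycle hMks
      haveI : IsMarkovKernel (cycle ks.reverse) :=
        isMarkovKernel_cycle fun η hη => hMks η (List.mem_reverse.mp hη)
      rw [cycle_cons, List.reverse_cons, cycle_append, cycle_cons, cycle_nil, Kernel.comp_id]
      exact (ih hMks fun η hη => h η (by simp [hη])).comp (h κ (by simp)).isAdjointPair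

/-- Both members of the pair leave `π` invariant (in particular the REVERSED sweep is exact). -/
theorem cycle_reverse_invariant [IsFiniteMeasure π] {Ks : List (Kernel α α)}
    (hM : ∀ κ ∈ Ks, IsMarkovKernel κ) (h : ∀ κ ∈ Ks, Kernel.IsReversible κ π) :
    Kernel.Invariant (cycle Ks.reverse) π := by
  haveI := isMarkovKernel_cycle hM
  exact (isAdjointPair_cycle_reverse hM h).symm.invariant

/-! ## §4 Engine instance: the SU(N) link update with the subgroup order reversed -/

section Engine

variable {n m : Type*} [Fintype n] [DecidableEq n] [Fintype m] [DecidableEq m]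

/-- The one-link Wilson law `e^{c Re tr (g R)} · Haar_SU(n)` is a finite measure. -/
instance isFiniteMeasure_linkLaw (c : ℝ) (R : Matrix n n ℂ) :
    IsFiniteMeasure ((Literature.MathematicalPhysics.QuantumFieldTheory.haarProbability
      (Matrix.specialUnitaryGroup n ℂ)).withDensity (linkWeight c R)) := by
  unfold linkWeight
  refine isFiniteMeasure_withDensity_ofReal (HasFiniteIntegral.of_bounded
    (C := Real.exp (|c| * ∑ i, ∑ j, ‖R i j‖)) (Filter.Eventually.of_forall fun g => ?_))
  rw [Real.norm_eq_abs, abs_of_pos (Real.exp_pos _)]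
  exact Real.exp_le_exp.mpr ((le_abs_self _).trans (abs_exponent_le c R g))

/-- **Reversed subgroup order = adjoint update**: the cycle of Cabibbo–Marinari hits over the frames
in reversed order is the adjoint, for the one-link Wilson law, of the cycle in the given order (the
engine's `reverse=True` subgroup loop); both leave the law invariant. -/
theorem cmLinkUpdate_reverse_isAdjointPair (frames : List (n ≃ Fin 2 ⊕ m)) (c : ℝ)
    (R : Matrix n n ℂ) :
    IsAdjointPair (cmLinkUpdate frames c R) (cmLinkUpdate frames.reverse c R)
      ((Literature.MathematicalPhysics.QuantumFieldTheory.haarProbability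
        (Matrix.specialUnitaryGroup n ℂ)).withDensity (linkWeight c R)) := by
  unfold cmLinkUpdate
  rw [List.map_reverse]
  refine isAdjointPair_cycle_reverse (fun κ hκ => ?_) (fun κ hκ => ?_)
  · obtain ⟨e, -, rfl⟩ := List.mem_map.mp hκ
    infer_instance
  · obtain ⟨e, -, rfl⟩ := List.mem_map.mp hκ
    exact cmHit_isReversible e c R

end Engine

end Summit.Ventures.LatticeQCDFlow.Exactness
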